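import Summits.SmoothPoincare4.SmoothPoincare4.Theorems.EntropyRungConicalGapRicciNormSqIntegrable
import Summits.SmoothPoincare4.SmoothPoincare4.Theorems.EntropyRungConicalGapRicciLevelFence
import Literature.Geometry.Riemannian.RicciFlowScalarCurvatureComparison
import HarnessLib

/-!
# The Ricci side of line `Sketch`, UNCONDITIONAL (crux `EntropyRung.ConicalGap`,
# stmt-SmoothPoincare4-16589; lead seat c4, cycle 4)

Compositions of the landed Ricci moment identity (`helper_ricciMomentIdentity`, p132292, stated
there GIVEN the integrability of `|Ric|² e^{-f/τ}` and `g⁻¹(dR, df) e^{-f/τ}`) with the Munteanu–Sesum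
weighted `L²` bound for `Ric` at every scale (`helper_ricciNormSq_integrable`,
`EntropyRungConicalGapRicciNormSqIntegrable.lean`, which discharges exactly those two provisos). On
every complete connected normalised 4-d gradient shrinking Ricci soliton `(M, g, f)`
(`Ric + Hess f = g/2`, `R + |∇f|² = f`), writing `v = e^{-f/τ}`, `Z = ∫ v`, `B = ∫ R v`,
`C = ∫ f R v`, `D = ∫ R² v`, `A = ∫ |Ric|² v`:

* `helper_ricciMomentIdentity_unconditional` — for every `τ > 0`,
  `2A = B + (τ − 1) [τ⁻² (C − D) − τ⁻¹ (2B − D)]`, with no proviso;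
* `helper_ricciMoment_tau_one` — the classical identities at `τ = 1`:
  `2 ∫ |Ric|² e^{-f} = ∫ R e^{-f}` and hence (`R² ≤ 4 |Ric|²`) `∫ R² e^{-f} ≤ 2 ∫ R e^{-f}`;
* `helper_ricciGradMoment` — `∫ g⁻¹(dR, df) v = 2 ∫ Ric(∇f, ∇f) v = τ⁻¹ (C − D) − (2B − D)`;
* `helper_coneExcess_deriv_ricciForm` — the τ-derivative of the CONE-EXCESS PROFILE `m(τ) = τ B/Z`
  in closed Ricci form: for `τ > 0`, `τ ≠ 1`,
  `m′(τ) = [2τ² A/Z − (τ − 1)² (D/Z − (B/Z)²) − τ B/Z] / (τ (τ − 1))`, i.e.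
  `τ(τ−1) m′ = 2τ² ⟨|Ric|²⟩_τ − (τ−1)² Var_τ(R) − τ ⟨R⟩_τ` — so the monotonicity `M` of cycle 3 is
  EXACTLY `2τ²⟨|Ric|²⟩_τ ≥ (τ−1)² Var_τ(R) + τ⟨R⟩_τ` for `τ > 1`;
* `helper_density_le_of_ricciLevel_unconditional`, `helper_conicalGap_of_ricciLevel_unconditional` —
  the Ricci-level fence of `EntropyRungConicalGapRicciLevelFence.lean` (p133516) with its integrability
  hypothesis discharged: `∀ τ > 1, (τ−1)² D + τ B ≤ 2τ² A` ⇒ `Θ ≤ a e^{ρ/2}`, and the crux on that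
  sub-class.

Everything here is proved; no definition and no named fact is introduced.

## References

* O. Munteanu, N. Sesum, J. Geom. Anal. 23 (2013) 539–561, Thm. 1.4 / 1.5. [MunteanuSesum2013]
* O. Munteanu, J. Wang, arXiv:1606.01861, §2 (p. 6). [MunteanuWang2016]
* Y. Wang, G. Wang (Wang–Wang 2023), arXiv:2308.06560, Prop. 2.6.
* P. Topping, *Lectures on the Ricci flow*, CUP 2006, Cor. 2.5.5 (`|Ric|² ≥ R²/n`). [Topping2006]
-/

noncomputable section

-- `Summit.SmoothPoincare4.SmoothPoincare4.…` (summit = problem) trips `dupNamespace` on every decl.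
set_option linter.dupNamespace false

open scoped Manifold ContDiff ENNReal NNReal Topology
open MeasureTheory Set Filter Module
open Literature.Geometry.Lorentzian Literature.Geometry.Riemannian

namespace Summit.SmoothPoincare4.SmoothPoincare4.Theorems.ConicalGapSketch

section RiemVolume

variable {M : Type} [TopologicalSpace M] [T2Space M] [SecondCountableTopology M]
  [ChartedSpace (EuclideanSpace ℝ (Fin 4)) M] [IsManifold (𝓡 4) ∞ M] [ConnectedSpace M]
  [T3Space M] [MeasurableSpace M] [BorelSpace M]

/-- **The Ricci moment identity, unconditional** (over `g.riemVolume`): on a complete connected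
normalised 4-d gradient shrinker, for every `τ > 0`,
`2 ∫ |Ric|² e^{-f/τ} = ∫ R e^{-f/τ} + (τ − 1) [τ⁻² ∫ (f R − R²) e^{-f/τ} − τ⁻¹ ∫ (2R − R²) e^{-f/τ}]`
(`ricciMoment_riemVolume` with its two provisos supplied by `ricciNormSq_integrable` and
`ricciNormSq_innerDual_integrable`). -/
theorem ricciMoment_riemVolume_unconditional
    (g : PseudoRiemannianMetric (𝓡 4) ∞ (EuclideanSpace ℝ (Fin 4)) (TangentSpace (𝓡 4) : M → Type _))
    [g.HasLeviCivita] (f : M → ℝ) (hg : g.IsRiemannian)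
    (hc : ∀ (x : M) (r : NNReal), IsCompact {y : M | g.edist hg x y ≤ r})
    (hf : ContMDiff (𝓡 4) 𝓘(ℝ, ℝ) ∞ f)
    (hsol : ∀ (x : M) (X Y : TangentSpace (𝓡 4) x),
      g.ricci x X Y + g.hessian f x X Y = (1 / 2 : ℝ) * g.val x X Y)
    (hnorm : ∀ x : M, g.scalarCurvature x + g.gradSq f x = f x) {τ : ℝ} (hτ : 0 < τ) :
    2 * ∫ x, g.normSq x (g.ricci x) * Real.exp (-f x / τ) ∂g.riemVolume =
      (∫ x, g.scalarCurvature x * Real.exp (-f x / τ) ∂g.riemVolume) +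
        (τ - 1) * ((τ ^ 2)⁻¹ *
          ((∫ x, f x * g.scalarCurvature x * Real.exp (-f x / τ) ∂g.riemVolume) -
            (∫ x, g.scalarCurvature x ^ 2 * Real.exp (-f x / τ) ∂g.riemVolume)) -
          τ⁻¹ * (2 * (∫ x, g.scalarCurvature x * Real.exp (-f x / τ) ∂g.riemVolume) -
            (∫ x, g.scalarCurvature x ^ 2 * Real.exp (-f x / τ) ∂g.riemVolume))) := by
  obtain ⟨hR0, -, hprop⟩ :=
    NoncompactShrinkerGapCarrilloNiClauses.scalarCurvature_nonneg_and_isCompact_sublevel g f hg hc hf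
      hsol hnorm
  exact ricciMoment_riemVolume g f hg hc hf hsol hnorm hτ
    (ricciNormSq_integrable hg hf hsol hnorm hprop hR0 hτ)
    (ricciNormSq_innerDual_integrable hg hf hsol hnorm hprop hR0 hτ)

/-- **`∫ g⁻¹(dR, df) e^{-f/τ} = τ⁻¹ ∫ (f R − R²) e^{-f/τ} − ∫ (2R − R²) e^{-f/τ}`** (over
`g.riemVolume`; `g⁻¹(dR, df) = 2 Ric(∇f, ∇f)`): Green (A) of the Ricci moment identity
(`ricciMoment_greenA`: `∫ R Δ(e^{-f/τ}) = τ⁻¹ ∫ g⁻¹(dR, df) e^{-f/τ}`), now unconditional. -/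
theorem ricciGradMoment_riemVolume
    (g : PseudoRiemannianMetric (𝓡 4) ∞ (EuclideanSpace ℝ (Fin 4)) (TangentSpace (𝓡 4) : M → Type _))
    [g.HasLeviCivita] (f : M → ℝ) (hg : g.IsRiemannian)
    (hc : ∀ (x : M) (r : NNReal), IsCompact {y : M | g.edist hg x y ≤ r})
    (hf : ContMDiff (𝓡 4) 𝓘(ℝ, ℝ) ∞ f)
    (hsol : ∀ (x : M) (X Y : TangentSpace (𝓡 4) x),
      g.ricci x X Y + g.hessian f x X Y = (1 / 2 : ℝ) * g.val x X Y)
    (hnorm : ∀ x : M, g.scalarCurvature x + g.gradSq f x = f x) {τ : ℝ} (hτ : 0 < τ) :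
    ∫ x, g.innerDual x (mvfderiv (𝓡 4) g.scalarCurvature x).toLinearMap
        (mvfderiv (𝓡 4) f x).toLinearMap * Real.exp (-f x / τ) ∂g.riemVolume =
      τ⁻¹ * ((∫ x, f x * g.scalarCurvature x * Real.exp (-f x / τ) ∂g.riemVolume) -
          (∫ x, g.scalarCurvature x ^ 2 * Real.exp (-f x / τ) ∂g.riemVolume)) -
        (2 * (∫ x, g.scalarCurvature x * Real.exp (-f x / τ) ∂g.riemVolume) -
          (∫ x, g.scalarCurvature x ^ 2 * Real.exp (-f x / τ) ∂g.riemVolume)) := by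
  obtain ⟨hR0, -, hprop⟩ :=
    NoncompactShrinkerGapCarrilloNiClauses.scalarCurvature_nonneg_and_isCompact_sublevel g f hg hc hf
      hsol hnorm
  have hA := ricciMoment_greenA hg hf hsol hnorm hprop hR0 hτ
    (ricciNormSq_innerDual_integrable hg hf hsol hnorm hprop hR0 hτ)
  simp only [Nat.cast_ofNat] at hA
  have hτ0 : τ ≠ 0 := hτ.ne'
  have h1 : τ * τ⁻¹ = 1 := mul_inv_cancel₀ hτ0
  have h2 : τ ^ 2 * (τ ^ 2)⁻¹ = 1 := mul_inv_cancel₀ (pow_ne_zero 2 hτ0)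
  -- atoms: `u = τ⁻¹`, `w = (τ²)⁻¹`; `X − u(C−D) + (2B−D) = −τ·hA − X·h1 + (C−D)u·h2 − (C−D)τw·h1 − (2B−D)·h1`
  linear_combination (-τ) * hA -
    (∫ x, g.innerDual x (mvfderiv (𝓡 4) g.scalarCurvature x).toLinearMap
        (mvfderiv (𝓡 4) f x).toLinearMap * Real.exp (-f x / τ) ∂g.riemVolume) * h1 +
    (((∫ x, f x * g.scalarCurvature x * Real.exp (-f x / τ) ∂g.riemVolume) -
      (∫ x, g.scalarCurvature x ^ 2 * Real.exp (-f x / τ) ∂g.riemVolume)) * τ⁻¹) * h2 -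
    (((∫ x, f x * g.scalarCurvature x * Real.exp (-f x / τ) ∂g.riemVolume) -
      (∫ x, g.scalarCurvature x ^ 2 * Real.exp (-f x / τ) ∂g.riemVolume)) * τ * (τ ^ 2)⁻¹) * h1 -
    (2 * (∫ x, g.scalarCurvature x * Real.exp (-f x / τ) ∂g.riemVolume) -
      (∫ x, g.scalarCurvature x ^ 2 * Real.exp (-f x / τ) ∂g.riemVolume)) * h1

/-- **The τ-derivative of the cone-excess profile in closed Ricci form** (over `g.riemVolume`): on a
complete connected normalised 4-d gradient shrinker, for `τ > 0`, `τ ≠ 1`, `m(s) = s ∫Re^{-f/s}/∫e^{-f/s}`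
has derivative `[2τ² A/Z − (τ−1)² (D/Z − (B/Z)²) − τ B/Z] / (τ(τ−1))` at `τ`
(`Z = ∫e^{-f/τ}`, `B = ∫Re^{-f/τ}`, `D = ∫R²e^{-f/τ}`, `A = ∫|Ric|²e^{-f/τ}`): the quotient-rule value
`B/Z + τ⁻¹(C/Z − (F/Z)(B/Z))` of `coneExcessMono_hasDerivAt`, the first weighted identity
`F − 2τZ = (1 − τ)B` and the Ricci moment identity `(τ−1)(C − τB) = 2τ²A − (τ−1)²D − τB`. -/
theorem coneExcess_hasDerivAt_ricciForm
    (g : PseudoRiemannianMetric (𝓡 4) ∞ (EuclideanSpace ℝ (Fin 4)) (TangentSpace (𝓡 4) : M → Type _))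
    [g.HasLeviCivita] (f : M → ℝ) (hg : g.IsRiemannian)
    (hc : ∀ (x : M) (r : NNReal), IsCompact {y : M | g.edist hg x y ≤ r})
    (hf : ContMDiff (𝓡 4) 𝓘(ℝ, ℝ) ∞ f)
    (hsol : ∀ (x : M) (X Y : TangentSpace (𝓡 4) x),
      g.ricci x X Y + g.hessian f x X Y = (1 / 2 : ℝ) * g.val x X Y)
    (hnorm : ∀ x : M, g.scalarCurvature x + g.gradSq f x = f x) {τ : ℝ} (hτ : 0 < τ) (hτ1 : τ ≠ 1) :
    HasDerivAt (fun s : ℝ ↦ s * ((∫ x, g.scalarCurvature x * Real.exp (-f x / s) ∂g.riemVolume) /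
        (∫ x, Real.exp (-f x / s) ∂g.riemVolume)))
      ((2 * τ ^ 2 * ((∫ x, g.normSq x (g.ricci x) * Real.exp (-f x / τ) ∂g.riemVolume) /
            (∫ x, Real.exp (-f x / τ) ∂g.riemVolume)) -
          (τ - 1) ^ 2 * ((∫ x, g.scalarCurvature x ^ 2 * Real.exp (-f x / τ) ∂g.riemVolume) /
              (∫ x, Real.exp (-f x / τ) ∂g.riemVolume) -
            ((∫ x, g.scalarCurvature x * Real.exp (-f x / τ) ∂g.riemVolume) /
              (∫ x, Real.exp (-f x / τ) ∂g.riemVolume)) ^ 2) -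
          τ * ((∫ x, g.scalarCurvature x * Real.exp (-f x / τ) ∂g.riemVolume) /
            (∫ x, Real.exp (-f x / τ) ∂g.riemVolume))) / (τ * (τ - 1))) τ := by
  obtain ⟨hR0, -, hprop⟩ :=
    NoncompactShrinkerGapCarrilloNiClauses.scalarCurvature_nonneg_and_isCompact_sublevel g f hg hc hf
      hsol hnorm
  have hder := coneExcessMono_hasDerivAt g f hg hc hf hsol hnorm hτ
  have hZpos : 0 < ∫ x, Real.exp (-f x / τ) ∂g.riemVolume :=
    selfSimilar_weight_pos g f hg τ (weightedIntegrability_riemVolume hg hf hsol hnorm hprop hR0 hτ).1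
  have hid := secondWeightedIdentity_firstIdentity g f hg hc hf hsol hnorm hτ
  have hRic := ricciMoment_riemVolume_unconditional g f hg hc hf hsol hnorm hτ
  refine hder.congr_deriv ?_
  -- abbreviations
  set Z := ∫ x, Real.exp (-f x / τ) ∂g.riemVolume with hZ
  set B := ∫ x, g.scalarCurvature x * Real.exp (-f x / τ) ∂g.riemVolume with hB
  set F := ∫ x, f x * Real.exp (-f x / τ) ∂g.riemVolume with hF
  set C := ∫ x, f x * g.scalarCurvature x * Real.exp (-f x / τ) ∂g.riemVolume with hC
  set D := ∫ x, g.scalarCurvature x ^ 2 * Real.exp (-f x / τ) ∂g.riemVolume with hD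
  set A := ∫ x, g.normSq x (g.ricci x) * Real.exp (-f x / τ) ∂g.riemVolume with hA
  have hZ0 : Z ≠ 0 := hZpos.ne'
  have hτ0 : τ ≠ 0 := hτ.ne'
  have hτ1' : τ - 1 ≠ 0 := sub_ne_zero.2 hτ1
  -- `F = 2τZ + (1 − τ)B` and `(τ−1)(C − τB) = 2τ²A − (τ−1)²D − τB`
  have hF' : F = 2 * τ * Z + (1 - τ) * B := by linear_combination hid
  have hRL : (τ - 1) * (C - τ * B) = 2 * τ ^ 2 * A - (τ - 1) ^ 2 * D - τ * B :=
    ricciLevel_excess_mul_eq hτ0 hRic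
  rw [hF']
  field_simp
  linear_combination Z * hRL

end RiemVolume

/-! ## Registered helpers (crux vocabulary) -/

/-- **Helper `helper_ricciMomentIdentity_unconditional` of line `Sketch`** (the Ricci moment identity at
every scale, `n = 4`, UNCONDITIONAL): on every complete connected normalised 4-d gradient shrinking
Ricci soliton and for every `τ > 0`,
`2 ∫ |Ric|² e^{-f/τ} dV = ∫ R e^{-f/τ} dV
  + (τ − 1) [τ⁻² (∫ f R e^{-f/τ} dV − ∫ R² e^{-f/τ} dV) − τ⁻¹ (2 ∫ R e^{-f/τ} dV − ∫ R² e^{-f/τ} dV)]`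
(`dV` the Riemannian measure of `g.toContMDiffRiemannianMetric hg`): `ricciMoment_riemVolume_unconditional`. -/
theorem helper_ricciMomentIdentity_unconditional : ∀ (M : Type) [TopologicalSpace M] [T2Space M] [SecondCountableTopology M] [ChartedSpace (EuclideanSpace ℝ (Fin 4)) M] [IsManifold (𝓡 4) ∞ M] [ConnectedSpace M] [T3Space M] [MeasurableSpace M] [BorelSpace M] (g : Literature.Geometry.Lorentzian.PseudoRiemannianMetric (𝓡 4) ∞ (EuclideanSpace ℝ (Fin 4)) (TangentSpace (𝓡 4) : M → Type _)) [g.HasLeviCivita] (f : M → ℝ) (hg : g.IsRiemannian), (∀ (x : M) (r : NNReal), IsCompact {y : M | g.edist hg x y ≤ r}) → ContMDiff (𝓡 4) 𝓘(ℝ, ℝ) ∞ f → (∀ (x : M) (X Y : TangentSpace (𝓡 4) x), g.ricci x X Y + g.hessian f x X Y = (1 / 2 : ℝ) * g.val x X Y) → (∀ x : M, g.scalarCurvature x + g.gradSq f x = f x) → ∀ τ : ℝ, 0 < τ → 2 * ∫ x, g.normSq x (g.ricci x) * Real.exp (-f x / τ) ∂(Literature.Geometry.Lorentzian.riemannianMeasure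 (g.toContMDiffRiemannianMetric hg)) = (∫ x, g.scalarCurvature x * Real.exp (-f x / τ) ∂(Literature.Geometry.Lorentzian.riemannianMeasure (g.toContMDiffRiemannianMetric hg))) + (τ - 1) * ((τ ^ 2)⁻¹ * ((∫ x, f x * g.scalarCurvature x * Real.exp (-f x / τ) ∂(Literature.Geometry.Lorentzian.riemannianMeasure (g.toContMDiffRiemannianMetric hg))) - (∫ x, g.scalarCurvature x ^ 2 * Real.exp (-f x / τ) ∂(Literature.Geometry.Lorentzian.riemannianMeasure (g.toContMDiffRiemannianMetric hg)))) - τ⁻¹ * (2 * (∫ x, g.scalarCurvature x * Real.exp (-f x / τ) ∂(Literature.Geometry.Lorentzian.riemannianMeasure (g.toContMDiffRiemannianMetric hg))) - (∫ x, g.scalarCurvature x ^ 2 * Real.exp (-f x / τ) ∂(Literature.Geometry.Lorentzian.riemannianMeasure (g.toContMDiffRiemannianMetric hg))))) := by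
  intro M _ _ _ _ _ _ _ _ _ g _ f hg hc hf hsol hnorm τ hτ
  rw [← PseudoRiemannianMetric.riemVolume_eq hg]
  exact ricciMoment_riemVolume_unconditional g f hg hc hf hsol hnorm hτ

/-- **Helper `helper_ricciMoment_tau_one` of line `Sketch`** (the classical weighted identities at
`τ = 1`, `n = 4`, UNCONDITIONAL): on every complete connected normalised 4-d gradient shrinking Ricci
soliton, `2 ∫ |Ric|² e^{-f} dV = ∫ R e^{-f} dV` (Munteanu–Sesum / Cao–Zhou: `∫ Δ_f R · e^{-f} = 0`) and,
since `R² ≤ 4 |Ric|²` pointwise (`trace_sq_le_finrank_mul_normSq`), `∫ R² e^{-f} dV ≤ 2 ∫ R e^{-f} dV`. -/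
theorem helper_ricciMoment_tau_one : ∀ (M : Type) [TopologicalSpace M] [T2Space M] [SecondCountableTopology M] [ChartedSpace (EuclideanSpace ℝ (Fin 4)) M] [IsManifold (𝓡 4) ∞ M] [ConnectedSpace M] [T3Space M] [MeasurableSpace M] [BorelSpace M] (g : Literature.Geometry.Lorentzian.PseudoRiemannianMetric (𝓡 4) ∞ (EuclideanSpace ℝ (Fin 4)) (TangentSpace (𝓡 4) : M → Type _)) [g.HasLeviCivita] (f : M → ℝ) (hg : g.IsRiemannian), (∀ (x : M) (r : NNReal), IsCompact {y : M | g.edist hg x y ≤ r}) → ContMDiff (𝓡 4) 𝓘(ℝ, ℝ) ∞ f → (∀ (x : M) (X Y : TangentSpace (𝓡 4) x), g.ricci x X Y + g.hessian f x X Y = (1 / 2 : ℝ) * g.val x X Y) → (∀ x : M, g.scalarCurvature x + g.gradSq f x = f x) → 2 * ∫ x, g.normSq x (g.ricci x) * Real.exp (-f x) ∂(Literature.Geometry.Lorentzian.riemannianMeasure (g.toContMDiffRiemannianMetric hg)) = ∫ x, g.scalarCurvature x * Real.exp (-f x) ∂(Literature.Geometry.Lorentzian.riemannianMeasure (g.toContMDiffRiemannianMetric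 hg)) ∧ ∫ x, g.scalarCurvature x ^ 2 * Real.exp (-f x) ∂(Literature.Geometry.Lorentzian.riemannianMeasure (g.toContMDiffRiemannianMetric hg)) ≤ 2 * ∫ x, g.scalarCurvature x * Real.exp (-f x) ∂(Literature.Geometry.Lorentzian.riemannianMeasure (g.toContMDiffRiemannianMetric hg)) := by
  intro M _ _ _ _ _ _ _ _ _ g _ f hg hc hf hsol hnorm
  rw [← PseudoRiemannianMetric.riemVolume_eq hg]
  obtain ⟨hR0, -, hprop⟩ :=
    NoncompactShrinkerGapCarrilloNiClauses.scalarCurvature_nonneg_and_isCompact_sublevel g f hg hc hf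
      hsol hnorm
  have h1 := ricciMoment_riemVolume_unconditional g f hg hc hf hsol hnorm one_pos
  simp only [div_one, sub_self, zero_mul, add_zero] at h1
  refine ⟨h1, ?_⟩
  -- `R² e^{-f} ≤ 4 |Ric|² e^{-f}` pointwise, integrated
  have iN := ricciNormSq_integrable hg hf hsol hnorm hprop hR0 one_pos
  have iR2 := ricciMoment_integrable_sq hg hf hsol hnorm hprop hR0 one_pos
  simp only [div_one] at iN iR2
  have hpt : ∀ x, g.scalarCurvature x ^ 2 * Real.exp (-f x) ≤
      4 * (g.normSq x (g.ricci x) * Real.exp (-f x)) := fun x ↦ by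
    have h := g.trace_sq_le_finrank_mul_normSq x hg (g.ricci x)
    rw [finrank_euclideanSpace_fin] at h
    have h' : g.scalarCurvature x ^ 2 ≤ 4 * g.normSq x (g.ricci x) := by exact_mod_cast h
    nlinarith [Real.exp_pos (-f x)]
  calc ∫ x, g.scalarCurvature x ^ 2 * Real.exp (-f x) ∂g.riemVolume
      ≤ ∫ x, 4 * (g.normSq x (g.ricci x) * Real.exp (-f x)) ∂g.riemVolume :=
        integral_mono iR2 (iN.const_mul 4) hpt
    _ = 2 * ∫ x, g.scalarCurvature x * Real.exp (-f x) ∂g.riemVolume := by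
        rw [integral_const_mul, ← h1]; ring

/-- **Helper `helper_ricciGradMoment` of line `Sketch`** (the weighted moment of `Ric(∇f, ∇f)`, `n = 4`,
UNCONDITIONAL): on every complete connected normalised 4-d gradient shrinking Ricci soliton and for every
`τ > 0`, `∫ g⁻¹(dR, df) e^{-f/τ} dV = τ⁻¹ (∫ f R e^{-f/τ} dV − ∫ R² e^{-f/τ} dV) − (2 ∫ R e^{-f/τ} dV − ∫ R² e^{-f/τ} dV)`
(`g⁻¹(dR, df) = 2 Ric(∇f, ∇f)` by `∇R = 2 Ric(∇f, ·)`): `ricciGradMoment_riemVolume`. -/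
theorem helper_ricciGradMoment : ∀ (M : Type) [TopologicalSpace M] [T2Space M] [SecondCountableTopology M] [ChartedSpace (EuclideanSpace ℝ (Fin 4)) M] [IsManifold (𝓡 4) ∞ M] [ConnectedSpace M] [T3Space M] [MeasurableSpace M] [BorelSpace M] (g : Literature.Geometry.Lorentzian.PseudoRiemannianMetric (𝓡 4) ∞ (EuclideanSpace ℝ (Fin 4)) (TangentSpace (𝓡 4) : M → Type _)) [g.HasLeviCivita] (f : M → ℝ) (hg : g.IsRiemannian), (∀ (x : M) (r : NNReal), IsCompact {y : M | g.edist hg x y ≤ r}) → ContMDiff (𝓡 4) 𝓘(ℝ, ℝ) ∞ f → (∀ (x : M) (X Y : TangentSpace (𝓡 4) x), g.ricci x X Y + g.hessian f x X Y = (1 / 2 : ℝ) * g.val x X Y) → (∀ x : M, g.scalarCurvature x + g.gradSq f x = f x) → ∀ τ : ℝ, 0 < τ → ∫ x, g.innerDual x (mvfderiv (𝓡 4) g.scalarCurvature x).toLinearMap (mvfderiv (𝓡 4) f x).toLinearMap * Real.exp (-f x / τ) ∂(Literature.Geometry.Lorentzian.riemannianMeasure (g.toContMDiffRiemannianMetric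 hg)) = τ⁻¹ * ((∫ x, f x * g.scalarCurvature x * Real.exp (-f x / τ) ∂(Literature.Geometry.Lorentzian.riemannianMeasure (g.toContMDiffRiemannianMetric hg))) - (∫ x, g.scalarCurvature x ^ 2 * Real.exp (-f x / τ) ∂(Literature.Geometry.Lorentzian.riemannianMeasure (g.toContMDiffRiemannianMetric hg)))) - (2 * (∫ x, g.scalarCurvature x * Real.exp (-f x / τ) ∂(Literature.Geometry.Lorentzian.riemannianMeasure (g.toContMDiffRiemannianMetric hg))) - (∫ x, g.scalarCurvature x ^ 2 * Real.exp (-f x / τ) ∂(Literature.Geometry.Lorentzian.riemannianMeasure (g.toContMDiffRiemannianMetric hg)))) := by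
  intro M _ _ _ _ _ _ _ _ _ g _ f hg hc hf hsol hnorm τ hτ
  rw [← PseudoRiemannianMetric.riemVolume_eq hg]
  exact ricciGradMoment_riemVolume g f hg hc hf hsol hnorm hτ

/-- **Helper `helper_coneExcess_deriv_ricciForm` of line `Sketch`** (the scale derivative of the
cone-excess profile `m(τ) = τ⟨R⟩_τ` in closed Ricci form, UNCONDITIONAL): on every complete connected
normalised 4-d gradient shrinking Ricci soliton, for every `τ > 0` with `τ ≠ 1`,
`m′(τ) = [2τ² A/Z − (τ−1)² (D/Z − (B/Z)²) − τ B/Z] / (τ(τ−1))` where `Z = ∫e^{-f/τ}dV`, `B = ∫Re^{-f/τ}dV`,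
`D = ∫R²e^{-f/τ}dV`, `A = ∫|Ric|²e^{-f/τ}dV` — i.e. `τ(τ−1)m′ = 2τ²⟨|Ric|²⟩_τ − (τ−1)² Var_τ(R) − τ⟨R⟩_τ`:
`coneExcess_hasDerivAt_ricciForm`. -/
theorem helper_coneExcess_deriv_ricciForm : ∀ (M : Type) [TopologicalSpace M] [T2Space M] [SecondCountableTopology M] [ChartedSpace (EuclideanSpace ℝ (Fin 4)) M] [IsManifold (𝓡 4) ∞ M] [ConnectedSpace M] [T3Space M] [MeasurableSpace M] [BorelSpace M] (g : Literature.Geometry.Lorentzian.PseudoRiemannianMetric (𝓡 4) ∞ (EuclideanSpace ℝ (Fin 4)) (TangentSpace (𝓡 4) : M → Type _)) [g.HasLeviCivita] (f : M → ℝ) (hg : g.IsRiemannian), (∀ (x : M) (r : NNReal), IsCompact {y : M | g.edist hg x y ≤ r}) → ContMDiff (𝓡 4) 𝓘(ℝ, ℝ) ∞ f → (∀ (x : M) (X Y : TangentSpace (𝓡 4) x), g.ricci x X Y + g.hessian f x X Y = (1 / 2 : ℝ) * g.val x X Y) → (∀ x : M, g.scalarCurvature x + g.gradSq f x = f x) →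 ∀ τ : ℝ, 0 < τ → τ ≠ 1 → HasDerivAt (fun s : ℝ ↦ s * ((∫ x, g.scalarCurvature x * Real.exp (-f x / s) ∂(Literature.Geometry.Lorentzian.riemannianMeasure (g.toContMDiffRiemannianMetric hg))) / (∫ x, Real.exp (-f x / s) ∂(Literature.Geometry.Lorentzian.riemannianMeasure (g.toContMDiffRiemannianMetric hg))))) ((2 * τ ^ 2 * ((∫ x, g.normSq x (g.ricci x) * Real.exp (-f x / τ) ∂(Literature.Geometry.Lorentzian.riemannianMeasure (g.toContMDiffRiemannianMetric hg))) / (∫ x, Real.exp (-f x / τ) ∂(Literature.Geometry.Lorentzian.riemannianMeasure (g.toContMDiffRiemannianMetric hg)))) - (τ - 1) ^ 2 * ((∫ x, g.scalarCurvature x ^ 2 * Real.exp (-f x / τ) ∂(Literature.Geometry.Lorentzian.riemannianMeasure (g.toContMDiffRiemannianMetric hg))) / (∫ x, Real.exp (-f x / τ) ∂(Literature.Geometry.Lorentzian.riemannianMeasure (g.toContMDiffRiemannianMetric hg))) - ((∫ x, g.scalarCurvature x * Real.exp (-f x / τ) ∂(Literature.Geometry.Lorentzian.riemannianMeasure (g.toContMDiffRiemannianMetric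 hg))) / (∫ x, Real.exp (-f x / τ) ∂(Literature.Geometry.Lorentzian.riemannianMeasure (g.toContMDiffRiemannianMetric hg)))) ^ 2) - τ * ((∫ x, g.scalarCurvature x * Real.exp (-f x / τ) ∂(Literature.Geometry.Lorentzian.riemannianMeasure (g.toContMDiffRiemannianMetric hg))) / (∫ x, Real.exp (-f x / τ) ∂(Literature.Geometry.Lorentzian.riemannianMeasure (g.toContMDiffRiemannianMetric hg))))) / (τ * (τ - 1))) τ := by
  intro M _ _ _ _ _ _ _ _ _ g _ f hg hc hf hsol hnorm τ hτ hτ1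
  rw [← PseudoRiemannianMetric.riemVolume_eq hg]
  exact coneExcess_hasDerivAt_ricciForm g f hg hc hf hsol hnorm hτ hτ1

/-- **Helper `helper_density_le_of_ricciLevel_unconditional` of line `Sketch`** (the Ricci-level fence,
UNCONDITIONAL): on every complete connected normalised 4-d gradient shrinking Ricci soliton satisfying
`(τ−1)² ∫R²e^{-f/τ} + τ ∫Re^{-f/τ} ≤ 2τ² ∫|Ric|²e^{-f/τ}` for all `τ > 1`, if `(16π²T²)⁻¹∫e^{-f/T} → a` and
`T⟨R⟩_T → ρ` then `∫ e^{-f} dV ≤ 16π² a e^{ρ/2}` (`helper_density_le_of_ricciLevel`, p133516, with its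
integrability hypothesis supplied by `helper_ricciNormSq_integrable`). -/
theorem helper_density_le_of_ricciLevel_unconditional : ∀ (M : Type) [TopologicalSpace M] [T2Space M] [SecondCountableTopology M] [ChartedSpace (EuclideanSpace ℝ (Fin 4)) M] [IsManifold (𝓡 4) ∞ M] [ConnectedSpace M] [T3Space M] [MeasurableSpace M] [BorelSpace M] (g : Literature.Geometry.Lorentzian.PseudoRiemannianMetric (𝓡 4) ∞ (EuclideanSpace ℝ (Fin 4)) (TangentSpace (𝓡 4) : M → Type _)) [g.HasLeviCivita] (f : M → ℝ) (hg : g.IsRiemannian), (∀ (x : M) (r : NNReal), IsCompact {y : M | g.edist hg x y ≤ r}) → ContMDiff (𝓡 4) 𝓘(ℝ, ℝ) ∞ f → (∀ (x : M) (X Y : TangentSpace (𝓡 4) x), g.ricci x X Y + g.hessian f x X Y = (1 / 2 : ℝ) * g.val x X Y) → (∀ x : M, g.scalarCurvature x + g.gradSq f x = f x) → (∀ τ : ℝ, 1 < τ → (τ - 1) ^ 2 * (∫ x, g.scalarCurvature x ^ 2 * Real.exp (-f x / τ) ∂(Literature.Geometry.Lorentzian.riemannianMeasure (g.toContMDiffRiemannianMetric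 hg))) + τ * (∫ x, g.scalarCurvature x * Real.exp (-f x / τ) ∂(Literature.Geometry.Lorentzian.riemannianMeasure (g.toContMDiffRiemannianMetric hg))) ≤ 2 * τ ^ 2 * ∫ x, g.normSq x (g.ricci x) * Real.exp (-f x / τ) ∂(Literature.Geometry.Lorentzian.riemannianMeasure (g.toContMDiffRiemannianMetric hg))) → ∀ a ρ : ℝ, Filter.Tendsto (fun T : ℝ ↦ (16 * Real.pi ^ 2 * T ^ 2)⁻¹ * ∫ x, Real.exp (-f x / T) ∂(Literature.Geometry.Lorentzian.riemannianMeasure (g.toContMDiffRiemannianMetric hg))) Filter.atTop (nhds a) → Filter.Tendsto (fun T : ℝ ↦ T * ((∫ x, g.scalarCurvature x * Real.exp (-f x / T) ∂(Literature.Geometry.Lorentzian.riemannianMeasure (g.toContMDiffRiemannianMetric hg))) / (∫ x, Real.exp (-f x / T) ∂(Literature.Geometry.Lorentzian.riemannianMeasure (g.toContMDiffRiemannianMetric hg))))) Filter.atTop (nhds ρ) → ∫ x, Real.exp (-f x) ∂(Literature.Geometry.Lorentzian.riemannianMeasure (g.toContMDiffRiemannianMetric hg)) ≤ 16 * Real.pi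 ^ 2 * a * Real.exp (ρ / 2) := by
  intro M _ _ _ _ _ _ _ _ _ g _ f hg hc hf hsol hnorm hRL a ρ ha hρ
  exact helper_density_le_of_ricciLevel M g f hg hc hf hsol hnorm
    (helper_ricciNormSq_integrable M g f hg hc hf hsol hnorm) hRL a ρ ha hρ

/-- **Helper `helper_conicalGap_of_ricciLevel_unconditional` of line `Sketch`** (the crux on the
Ricci-level sub-class, UNCONDITIONAL): on the crux class, if `(τ−1)² ∫R²e^{-f/τ} + τ ∫Re^{-f/τ} ≤ 2τ² ∫|Ric|²e^{-f/τ}`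
for all `τ > 1`, `(16π²T²)⁻¹∫e^{-f/T} → a`, `T⟨R⟩_T → ρ` and `16π² a e^{ρ/2} ≤ 32π²√π e^{-3/2}`, then
`∫⁻ ofReal (e^{-f}) dV ≤ ofReal (32π²√π e^{-3/2})` (`helper_conicalGap_of_ricciLevel`, p133516, with its
integrability hypothesis supplied by `helper_ricciNormSq_integrable`). -/
theorem helper_conicalGap_of_ricciLevel_unconditional : ∀ (M : Type) [TopologicalSpace M] [T2Space M] [SecondCountableTopology M] [ChartedSpace (EuclideanSpace ℝ (Fin 4)) M] [IsManifold (𝓡 4) ∞ M] [ConnectedSpace M] [NoncompactSpace M] [T3Space M] [MeasurableSpace M] [BorelSpace M] (g : Literature.Geometry.Lorentzian.PseudoRiemannianMetric (𝓡 4) ∞ (EuclideanSpace ℝ (Fin 4)) (TangentSpace (𝓡 4) : M → Type _)) [g.HasLeviCivita] (f : M → ℝ) (hg : g.IsRiemannian), (∀ (x : M) (r : NNReal), IsCompact {y : M | g.edist hg x y ≤ r}) → ContMDiff (𝓡 4) 𝓘(ℝ, ℝ) ∞ f → (∀ (x : M) (X Y : TangentSpace (𝓡 4) x), g.ricci x X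 Y + g.hessian f x X Y = (1 / 2 : ℝ) * g.val x X Y) → (∀ x : M, g.scalarCurvature x + g.gradSq f x = f x) → (∃ x : M, g.scalarCurvature x ≠ 0) → (∀ ε : ℝ, 0 < ε → ∃ K : Set M, IsCompact K ∧ ∀ x, x ∉ K → g.scalarCurvature x < ε) → (∀ τ : ℝ, 1 < τ → (τ - 1) ^ 2 * (∫ x, g.scalarCurvature x ^ 2 * Real.exp (-f x / τ) ∂(Literature.Geometry.Lorentzian.riemannianMeasure (g.toContMDiffRiemannianMetric hg))) + τ * (∫ x, g.scalarCurvature x * Real.exp (-f x / τ) ∂(Literature.Geometry.Lorentzian.riemannianMeasure (g.toContMDiffRiemannianMetric hg))) ≤ 2 * τ ^ 2 * ∫ x, g.normSq x (g.ricci x) * Real.exp (-f x / τ) ∂(Literature.Geometry.Lorentzian.riemannianMeasure (g.toContMDiffRiemannianMetric hg))) → ∀ a ρ : ℝ, Filter.Tendsto (fun T : ℝ ↦ (16 * Real.pi ^ 2 * T ^ 2)⁻¹ * ∫ x, Real.exp (-f x / T) ∂(Literature.Geometry.Lorentzian.riemannianMeasure (g.toContMDiffRiemannianMetric hg))) Filter.atTop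 (nhds a) → Filter.Tendsto (fun T : ℝ ↦ T * ((∫ x, g.scalarCurvature x * Real.exp (-f x / T) ∂(Literature.Geometry.Lorentzian.riemannianMeasure (g.toContMDiffRiemannianMetric hg))) / (∫ x, Real.exp (-f x / T) ∂(Literature.Geometry.Lorentzian.riemannianMeasure (g.toContMDiffRiemannianMetric hg))))) Filter.atTop (nhds ρ) → 16 * Real.pi ^ 2 * a * Real.exp (ρ / 2) ≤ 32 * Real.pi ^ 2 * Real.sqrt Real.pi * Real.exp (-(3 : ℝ) / 2) → ∫⁻ x, ENNReal.ofReal (Real.exp (-f x)) ∂(Literature.Geometry.Lorentzian.riemannianMeasure (g.toContMDiffRiemannianMetric hg)) ≤ ENNReal.ofReal (32 * Real.pi ^ 2 * Real.sqrt Real.pi * Real.exp (-(3 : ℝ) / 2)) := by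
  intro M _ _ _ _ _ _ _ _ _ _ g _ f hg hc hf hsol hnorm hnf hdec hRL a ρ ha hρ hbudget
  exact helper_conicalGap_of_ricciLevel M g f hg hc hf hsol hnorm hnf hdec
    (helper_ricciNormSq_integrable M g f hg hc hf hsol hnorm) hRL a ρ ha hρ hbudget

end Summit.SmoothPoincare4.SmoothPoincare4.Theorems.ConicalGapSketch

end
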